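import Literature.AnabelianGeometry.EtaleTheta.GalSectCuspPairQuotientGalois
import Literature.AnabelianGeometry.EtaleTheta.GalSectTateModuleOfChi
import Literature.AnabelianGeometry.EtaleTheta.GalSectCuspCyclotomicInertia
import Literature.NumberTheory.GaloisRepresentations.TateModuleKummerCompletion
import Literature.NumberTheory.GaloisRepresentations.ContinuousCohomologyTransport
import Literature.AnabelianGeometry.EtaleTheta.SettingModelKrullOpenSubgroups
import HarnessLib

/-!
# [GalSect] §4 «the splittings form a torsor over `H¹(G_K, Ẑ(1)) ≅ (K^×)^∧`» — the structure group `Ker(res)` of a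
# CYCLOTOMIC cuspidal pair IS `(K^×)^∧` (Kummer theory at the cusp; «κ from clause (1)», proof-only)

S. Mochizuki, *Galois sections in absolute anabelian geometry* [GalSect], Nagoya Math. J. **179** (2005), §4 p. 33: «we have
an exact sequence `1 → I_x → D_x → G_K → 1`, `I_x ≅ Ẑ(1)` … the splittings … form a torsor over `H¹(G_K, Ẑ(1)) ≅ (K^×)^∧`»
[cite: MochizukiGalSect2005, §4 p.33]; classical inputs: inflation–restriction in degree one (Brown IV §2 / NSW I §2),
`H¹_cont(G_K, Ẑ(1)) = lim_n H¹(G_K, μ_n)` (NSW II §7 Thm. 2.7.5) and Kummer theory `H¹(G_K, μ_n) = K^×/(K^×)ⁿ` (Serre,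
*Galois Cohomology* II §1.2) for a `p`-adic field, whose power classes are finite [cite: NeukirchSchmidtWingberg2008, II §7 Thm 2.7.5]
[cite: SerreGaloisCohomology1997, II §1.2].  abc-iut cell, layer L2, seat abc-iut-w5-d051 (gen 5); ROWS #73 R600 (B), file B4
(ASSEMBLY).  PROOF-ONLY: no definition, no instance, no named fact.

abc-iut-w5-d029's `GalSectSplittingsCohomology` PROVED the torsor sentence with structure group
`Ker(res : H¹(D, I) → H¹(I, I)) ≅ H¹(D/I, I)` («print's `H¹(G_K, Ẑ(1))` only after … its identification with `(K^×)^∧` (Kummer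
theory — the origin predicate's content, untouched)»), and their C7e clause (2) constructor `DotCCusp.ofStructureGroupIso`
(p454786) takes exactly a group isomorphism `κ : (K^×)^∧ ≃* Ker(res)` as input (d′).  THIS FILE PRODUCES `κ` from C7e clause (1):

* **`GalSect.CuspPair.nonempty_kxHat_mulEquiv_resKer`** — for a cuspidal pair `P = (D, I)` in a topological group `Γ` with a
  continuous augmentation `α : Γ → G_{ℚ_p}` and a tempered curve `X` (base field `K`), if `I = D ∩ Ker α`, `D` is compact,
  `α(D) = G_K`, the pair is CYCLOTOMIC (`P.IsCyclotomic α`: `I ≃ₜ* Ẑ` with `d` acting by `χ(α d)`) and `S₀` is a splitting, then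
  `Nonempty (KxHat X ≃* Ker(res))` — `(K^×)^∧ ≅ H¹(G_K, Ẑ(1)) ≅ H¹(D/I, I) ≅ Ker(res)`.

Chain BY NAME: `CuspPair.exists_quotTop_continuousMulEquiv_absoluteGaloisGroup` (B3: `D/I ≃ₜ* Gal(K^al/K)` with `ι`),
`GalSect.exists_zHat_continuousAddEquiv_tateModule` (B2: `Ẑ ≃ₜ+ Ẑ(1)(K^al)`, `χ ↦` Galois action), the coefficient isomorphism
`I ≅ Ẑ(1)(K^al)` built from clause (1), abc-iut-L4's transport `continuousCohomologyAddEquivOfContinuousMulEquiv`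
(`ContinuousCohomologyTransport`) and Kummer isomorphism `continuousCohomologyOneTateModuleEquivCompletion`
(`TateModuleKummerCompletion`; finiteness of `K^×/(K^×)ⁿ` for the finite extension `K/ℚ_p` via abc-iut-L2-t11's
`IntermediateField.finite_units_quotient_range_powMonoidHom`), and `CuspPair.resKerEquivH1Quotient`.

HONEST FRAMING: classical Galois/Kummer theory, OUR kernel check over the tree's interfaces; [GalSect] is refereed; nothing of
[EtTh] is asserted; no side taken on [IUTchIII] Cor. 3.12; typed ≠ proved.
-/

noncomputable section

namespace Literature.AnabelianGeometry.EtaleTheta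

open CategoryTheory ProfiniteGrp ProfiniteGrp.ProfiniteCompletion Field TopRep ContRepresentation
open Literature.AnabelianGeometry.SemiGraphs _root_.Topology
open Literature.NumberTheory.GaloisRepresentations Literature.NumberTheory.GaloisRepresentations.DiscreteGaloisModule
open scoped Pointwise IsMulCommutative

namespace GalSect

namespace CuspPair

variable {p : ℕ} [Fact p.Prime]
variable {Γ : Type} [Group Γ] [TopologicalSpace Γ] [IsTopologicalGroup Γ] [T1Space Γ]

/-- Finiteness of the power classes `K^×/(K^×)ⁿ` of the base field `K` of a tempered curve (a finite extension of `ℚ_p`,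
hence a non-archimedean local field: abc-iut-L2-t11's `IntermediateField.finite_units_quotient_range_powMonoidHom`, over
`FiniteExtension.isNonarchimedeanLocalField` + `finite_quotient_range_powMonoidHom_units`). [cite: SerreGaloisCohomology1997, II §5.1 (a)] -/
theorem finiteIndex_range_powMonoidHom_units_K (X : TemperedCurve p) (n : ℕ+) :
    ((powMonoidHom (n : ℕ) : (X.K)ˣ →* (X.K)ˣ).range).FiniteIndex := by
  haveI : FiniteDimensional ℚ_[p] X.K := X.finiteDimensional_K
  haveI := IntermediateField.finite_units_quotient_range_powMonoidHom (p := p) X.K n.ne_zero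
  exact Subgroup.finiteIndex_of_finite_quotient

omit [T1Space Γ] in
/-- **Step 1 — the coefficient isomorphism `I ≅ Ẑ(1)(K^al)`.**  For a CYCLOTOMIC cuspidal pair and an identification
`e : D/I ≃ₜ* Gal(K^al/K)` compatible with `ι : K^al ≅ ℚ̄_p` (`ι (e[d] • y) = α d • ι y`, file B3), the coefficient module
`Additive ↥I` of `H¹(D/I, I)` is isomorphic, as a topological `ℤ`-module, to the Tate module `Ẑ(1)(K^al)`, EQUIVARIANTLY along `e`
(clause (1) `I ≃ₜ* Ẑ` with `d ↦ χ(α d)`, then file B2's `Ẑ ≃ₜ+ Ẑ(1)(K^al)`, `χ(σ) ↦ τ`). [cite: MochizukiGalSect2005, §4 p.33] -/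
theorem exists_coeff_equiv_tateModule (X : TemperedCurve p) (P : CuspPair Γ) [IsMulCommutative P.I] (α : Γ →ₜ* GQp p)
    (hcyc : P.IsCyclotomic α.toMonoidHom) (ι : AlgebraicClosure X.K ≃ₐ[X.K] PadicAlgCl p) :
    haveI := P.ID_normal
    ∀ e : ((⊤ : Subgroup P.D) ⧸ P.ID.subgroupOf ⊤) ≃ₜ* absoluteGaloisGroup X.K,
      (∀ (d : (⊤ : Subgroup P.D)) (y : AlgebraicClosure X.K),
          ι (e (QuotientGroup.mk d) • y) = α ((d : P.D) : Γ) • ι y) →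
        ∃ cL : Additive P.ID ≃L[ℤ] (muSystem X.K).limit,
          ∀ (q : (⊤ : Subgroup P.D) ⧸ P.ID.subgroupOf ⊤) (a : Additive P.ID),
            cL ((quotConjTopRep (MonoidHom.id P.D) P.ID ⊤ P.conjNormal_ID_eq).ρ q a) =
              (tateModuleMu X.K).toTopRep.ρ (e q) (cL a) := by
  haveI := P.ID_normal
  intro e he
  -- (B2) the module: `Ẑ ≃ₜ+ Ẑ(1)(K^al)`, `χ(σ) ↦ τ`
  obtain ⟨T, hT⟩ := GalSect.exists_zHat_continuousAddEquiv_tateModule p X.K ι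
  -- clause (1): `I ≃ₜ* Ẑ` with `d` acting by `χ(α d)`
  obtain ⟨eI, heI⟩ := hcyc
  -- `I` read inside `D` is `I`
  let idI : P.ID ≃* P.I :=
    { toFun := fun x => ⟨((x : P.D) : Γ), Subgroup.mem_subgroupOf.mp x.2⟩
      invFun := fun y => ⟨⟨(y : Γ), P.I_le y.2⟩, Subgroup.mem_subgroupOf.mpr y.2⟩
      left_inv := fun x => rfl
      right_inv := fun y => rfl
      map_mul' := fun x y => rfl }
  have hidI : Continuous idI := (continuous_subtype_val.comp continuous_subtype_val).subtype_mk _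
  have hidIs : Continuous idI.symm := (continuous_subtype_val.subtype_mk _).subtype_mk _
  -- the coefficient isomorphism `Additive I ≅ Ẑ(1)(K^al)`
  let cfun : Additive P.ID → (muSystem X.K).limit := fun a => T (Additive.ofMul (eI (idI (Additive.toMul a))))
  let cinv : (muSystem X.K).limit → Additive P.ID := fun y =>
    Additive.ofMul (idI.symm (eI.symm (Additive.toMul (T.symm y))))
  have c_left : ∀ a, cinv (cfun a) = a := fun a => by
    simp only [cfun, cinv, ContinuousAddEquiv.symm_apply_apply, toMul_ofMul, ContinuousMulEquiv.symm_apply_apply,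
      MulEquiv.symm_apply_apply, ofMul_toMul]
  have c_right : ∀ y, cfun (cinv y) = y := fun y => by
    simp only [cfun, cinv, toMul_ofMul, MulEquiv.apply_symm_apply, ContinuousMulEquiv.apply_symm_apply, ofMul_toMul,
      ContinuousAddEquiv.apply_symm_apply]
  have c_add : ∀ a b, cfun (a + b) = cfun a + cfun b := fun a b => by
    simp only [cfun, toMul_add, map_mul, ofMul_mul, map_add]
  have c_cont : Continuous cfun :=
    T.continuous.comp (continuous_ofMul.comp (eI.continuous.comp (hidI.comp continuous_toMul)))
  have c_cont' : Continuous cinv :=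
    continuous_ofMul.comp (hidIs.comp (eI.symm.continuous.comp (continuous_toMul.comp T.symm.continuous)))
  let cA : Additive P.ID →+ (muSystem X.K).limit :=
    { toFun := cfun, map_zero' := by
        have h := c_add 0 0
        rw [add_zero] at h
        have h' : cfun 0 + cfun 0 = cfun 0 + 0 := by rw [add_zero]; exact h.symm
        exact add_left_cancel h'
      map_add' := c_add }
  refine ⟨{ cA.toIntLinearMap with
      invFun := cinv
      left_inv := c_left
      right_inv := c_right
      continuous_toFun := c_cont
      continuous_invFun := c_cont' }, fun q a => ?_⟩
  induction q using QuotientGroup.induction_on with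
  | H d => ?_
  rw [quotConjTopRep_ρ_mk]
  change T (Additive.ofMul (eI (idI (MulAut.conjNormal ((MonoidHom.id P.D) (d : P.D)) (Additive.toMul a))))) =
    (tateModuleMu X.K).toTopRep.ρ (e (QuotientGroup.mk d)) (T (Additive.ofMul (eI (idI (Additive.toMul a)))))
  have hconj : idI (MulAut.conjNormal ((MonoidHom.id P.D) (d : P.D)) (Additive.toMul a)) =
      ⟨((d : P.D) : Γ) * (idI (Additive.toMul a) : Γ) * ((d : P.D) : Γ)⁻¹,
        P.conj_mem_I (d : P.D).2 (idI (Additive.toMul a)).2⟩ :=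
    Subtype.ext (by
      change (((MulAut.conjNormal ((MonoidHom.id P.D) (d : P.D)) (Additive.toMul a) : P.ID) : P.D) : Γ) = _
      rw [MulAut.conjNormal_apply, MonoidHom.id_apply, Subgroup.coe_mul, Subgroup.coe_mul, Subgroup.coe_inv]
      rfl)
  rw [hconj, heI _ (d : P.D).2, hT (α.toMonoidHom ((d : P.D) : Γ)) (e (QuotientGroup.mk d)) (he d)]

omit [T1Space Γ] in
/-- **Step 2 — transport of `H¹` along `e`.**  Given `e : D/I ≃ₜ* Gal(K^al/K)` and an `e`-equivariant topological
isomorphism of coefficients `Additive ↥I ≅ Ẑ(1)(K^al)`, the continuous cohomology groups `H¹(D/I, I)` and `H¹(G_K, Ẑ(1)(K^al))`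
are isomorphic (abc-iut-L4's `continuousCohomologyAddEquivOfContinuousMulEquiv`, `ContinuousCohomologyTransport`).
[cite: NeukirchSchmidtWingberg2008, II §7 Thm 2.7.5] -/
theorem nonempty_h1_addEquiv_tateModule (X : TemperedCurve p) (P : CuspPair Γ) [IsMulCommutative P.I] :
    haveI := P.ID_normal
    ∀ (e : ((⊤ : Subgroup P.D) ⧸ P.ID.subgroupOf ⊤) ≃ₜ* absoluteGaloisGroup X.K)
      (cL : Additive P.ID ≃L[ℤ] (muSystem X.K).limit),
      (∀ (q : (⊤ : Subgroup P.D) ⧸ P.ID.subgroupOf ⊤) (a : Additive P.ID),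
          cL ((quotConjTopRep (MonoidHom.id P.D) P.ID ⊤ P.conjNormal_ID_eq).ρ q a) =
            (tateModuleMu X.K).toTopRep.ρ (e q) (cL a)) →
        Nonempty (continuousCohomology 1 (quotConjTopRep (MonoidHom.id P.D) P.ID ⊤ P.conjNormal_ID_eq) ≃+
          continuousCohomology 1 (tateModuleMu X.K).toTopRep) := by
  haveI := P.ID_normal
  intro e cL hc
  let Xq : TopRep ℤ ((⊤ : Subgroup P.D) ⧸ P.ID.subgroupOf ⊤) :=
    quotConjTopRep (MonoidHom.id P.D) P.ID ⊤ P.conjNormal_ID_eq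
  let Y : TopRep ℤ (absoluteGaloisGroup X.K) := (tateModuleMu X.K).toTopRep
  obtain ⟨φm, hφm⟩ : ∃ φm : TopRep.res ((e.symm : absoluteGaloisGroup X.K →ₜ* ((⊤ : Subgroup P.D) ⧸ P.ID.subgroupOf ⊤)) :
      absoluteGaloisGroup X.K →* ((⊤ : Subgroup P.D) ⧸ P.ID.subgroupOf ⊤)) Xq ⟶ Y, ∀ a, φm.hom a = cL a :=
    ⟨TopRep.ofHom ⟨cL.toContinuousLinearMap, fun g => ContinuousLinearMap.ext fun a => by
        change cL (Xq.ρ (e.symm g) a) = Y.ρ g (cL a)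
        rw [hc, ContinuousMulEquiv.apply_symm_apply]⟩, fun a => rfl⟩
  obtain ⟨ψm, hψm⟩ : ∃ ψm : TopRep.res ((e : ((⊤ : Subgroup P.D) ⧸ P.ID.subgroupOf ⊤) →ₜ* absoluteGaloisGroup X.K) :
      ((⊤ : Subgroup P.D) ⧸ P.ID.subgroupOf ⊤) →* absoluteGaloisGroup X.K) Y ⟶ Xq, ∀ y, ψm.hom y = cL.symm y :=
    ⟨TopRep.ofHom ⟨cL.symm.toContinuousLinearMap, fun q => ContinuousLinearMap.ext fun y => by
        rw [ContinuousLinearMap.comp_apply, ContinuousLinearMap.comp_apply, ContinuousLinearEquiv.coe_coe,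
          ContRepresentation.restrict_apply_apply, ContinuousLinearEquiv.symm_apply_eq, hc,
          ContinuousLinearEquiv.apply_symm_apply]
        rfl⟩, fun y => rfl⟩
  have hψφ : ∀ x : Xq, ψm.hom (φm.hom x) = x := fun x => by
    rw [hφm, hψm, ContinuousLinearEquiv.symm_apply_apply]
  have hφψ : ∀ y : Y, φm.hom (ψm.hom y) = y := fun y => by
    rw [hψm, hφm, ContinuousLinearEquiv.apply_symm_apply]
  exact ⟨continuousCohomologyAddEquivOfContinuousMulEquiv e φm ψm hψφ hφψ 1⟩

/-- **The structure group of a cyclotomic cuspidal pair is `(K^×)^∧`** ([GalSect] §4 p. 33: «`I_x ≅ Ẑ(1)` … a torsor over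
`H¹(G_K, Ẑ(1)) ≅ (K^×)^∧`»).  Let `P = (D, I)` be a cuspidal pair in a topological group `Γ`, `α : Γ → G_{ℚ_p}` a continuous
augmentation and `X` a tempered curve with base field `K`, such that `I = D ∩ Ker α`, `D` is compact, `α(D) = G_K` and the pair is
cyclotomic (C7e clause (1), `IsCyclotomic`).  Then for every splitting `S₀` the kernel of restriction
`Ker(res : H¹(D, I) → H¹(I, I))` — the structure group of the genuine torsor of splittings (`torsorDataH1`) — is isomorphic to
`(K^×)^∧ = KxHat X`: the datum (d′) of abc-iut-w5-d029's `DotCCusp.ofStructureGroupIso`. [cite: MochizukiGalSect2005, §4 p.33] -/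
theorem nonempty_kxHat_mulEquiv_resKer (X : TemperedCurve p) (P : CuspPair Γ) [IsMulCommutative P.I] (α : Γ →ₜ* GQp p)
    (hI : P.I = P.D ⊓ α.toMonoidHom.ker) (hD : IsCompact (P.D : Set Γ)) (hα : P.D.map α.toMonoidHom = X.GK)
    (hcyc : P.IsCyclotomic α.toMonoidHom) {S₀ : Subgroup Γ} (hS₀ : S₀ ∈ P.splittings) :
    haveI := P.ID_normal
    Nonempty (KxHat X ≃*
      ↥(ContH1.resKer P.ID (⊤ : Subgroup P.D) (P.isClosedComplement_of_mem_splittings hS₀).le_left)) := by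
  haveI := P.ID_normal
  -- (B3) the group: `D/I ≃ₜ* Gal(K^al/K)` with `ι (e[d] • y) = α d • ι y`
  obtain ⟨ι, e, he⟩ := P.exists_quotTop_continuousMulEquiv_absoluteGaloisGroup X α hI hD hα
  -- Step 1: coefficients; Step 2: transport of `H¹`
  obtain ⟨cL, hc⟩ := P.exists_coeff_equiv_tateModule X α hcyc ι e he
  obtain ⟨H1⟩ := P.nonempty_h1_addEquiv_tateModule X e cL hc
  -- Kummer theory `H¹(G_K, Ẑ(1)) ≃ (K^×)^∧` (abc-iut-L4)
  obtain ⟨KE⟩ : Nonempty (continuousCohomology 1 (tateModuleMu X.K).toTopRep ≃+ Additive (completion (GrpCat.of (X.K)ˣ))) :=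
    ⟨@continuousCohomologyOneTateModuleEquivCompletion X.K _
      (charZero_of_injective_algebraMap (algebraMap ℚ_[p] X.K).injective) (finiteIndex_range_powMonoidHom_units_K X)⟩
  -- `Ker(res) ≃* H¹(D/I, I)` (abc-iut-w5-d029)
  obtain ⟨R⟩ : Nonempty (↥(ContH1.resKer P.ID (⊤ : Subgroup P.D) (P.isClosedComplement_of_mem_splittings hS₀).le_left) ≃*
      Multiplicative (continuousCohomology 1 (quotConjTopRep (MonoidHom.id P.D) P.ID ⊤ P.conjNormal_ID_eq))) :=
    ⟨P.resKerEquivH1Quotient hS₀⟩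
  exact ⟨(R.trans ((AddEquiv.toMultiplicative H1).trans (AddEquiv.toMultiplicativeLeft KE))).symm⟩

end CuspPair

end GalSect

end Literature.AnabelianGeometry.EtaleTheta

end
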